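import Mathlib.Algebra.Order.Chebyshev
import Literature.MathematicalPhysics.QuantumFieldTheory.Balaban1983to89.B5Composition116
import Summits.QuantumFields.BalabanUV.T4Continuum.Support.GradedSubBlocksRefine

/-!
# T⁴ programme, spine node NE2 (U1a), sub-row Δ1 — THE GRADED WELL, supplier brick «GW-V» file A: CONTOUR MEANS OF MEANS
# (a scale-`s` straight-contour average is the mean of `(s/t)^{d+1}` scale-`t` sub-contour averages, `t ∣ s`) and JENSEN

NE2 leaf prover 07, GEN 11 (`b2b-balaban-t4-ne2-formalise-leaf-07-g11`, numerics desk of sub-row Δ1), supplier brick for the row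
owner's GRADED WELL (R47 journal 2026-08-21 l.25022; objects `GradedSubBlocks` p244783 / `GradedWellData` p244847).  The vector twin of
`GradedSubBlocksRefine.sum_inSub_refine` (block means of means): for `t ∣ s` the straight contour of `s` bonds from every site of a
scale-`s` sub-block is the concatenation of `s/t` contours of `t` bonds starting at the sites `x + q·t·e_μ`, and the scale-`s` sub-block is
the union of `(s/t)^d` scale-`t` sub-blocks; hence (`avgS_refine`)
`Σ_{o ∈ [0,s/t)^d} Σ_{q < s/t} (Q_t A)(z + t·o + q·t·e_μ, μ) = (s/t)^{d+1}·(Q_s A)(z, μ)`,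
and by Cauchy–Schwarz (`norm_sq_avgS_le`) `|(Q_s A)(z,μ)|² ≤ (s/t)^{−(d+1)}·Σ_{o,q} |(Q_t A)(z + t·o + q·t·e_μ, μ)|²`.
This is the combinatorial half of «GW-V» (journal l.25494 / memo `t4/T4-EST-NE2-D1-COLLAR.md` v1.1 §9.1b): the graded vector mass of the
typed `RowV` dominates the all-unit torus mass; file B assembles it on `GradedWellData`.

 * §1 (`tstep_add` is `B5Composition116`'s) `anchor_of_dvd`, `anchor_add_tstep_mul`, `mulOff`, `anchor_site_mulOff`, `subAnc` (the scale-`t` anchor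
   `z + t·o + q·t·e_μ` of a scale-`s` anchor `z`), `combOff` / `site_site_mulOff` (offsets compose);
 * §2 `avgS_refine`; §3 `norm_sq_sum_le` (finite Jensen), `norm_sq_avgS_le`.

HONEST FRAMING (T4-DAG p. 1).  [folklore] finite-torus combinatorics and Cauchy–Schwarz; no estimate of Bałaban's; NE2 (U1a) NOT proved;
spine PROVED 0/9 unchanged; NOT [B9] (3.16)/(3.23)–(3.27) as printed; NOT infinite volume / mass gap / Clay.  HONEST DEPENDENCY: continuum YM
on T⁴ ⇐ BetaPertH ∧ nine spine estimates (0/9 proved); BetaPertH ⇐ (D1) ∧ (D4) ∧ CAP+tail; G-an2-4 gates asym, D1 and NE2/3/4.  No `sorry`.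
-/

noncomputable section

open scoped BigOperators ComplexConjugate Matrix
open Finset

namespace Summit.QuantumFields.BalabanUV.T4Continuum.GradedContourRefine

open Literature.MathematicalPhysics.QuantumFieldTheory.Balaban1983to89.B5Prop11Plancherel (Tor unitVec)
open Literature.MathematicalPhysics.QuantumFieldTheory.Balaban1983to89.B5Block118 (tstep tstep_zero tstep_succ)
open Literature.MathematicalPhysics.QuantumFieldTheory.Balaban1983to89.B5Composition116 (tstep_add)
open Summit.QuantumFields.BalabanUV.T4Continuum
open Summit.QuantumFields.BalabanUV.T4Continuum.GradedSubBlocks (Anchor Anc InSub site meanS avgS avgS_mulVec s_pos site_add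
  val_site anchor_add_tstep)

variable {d : ℕ} (N : Fin d → ℕ) [hN : ∀ ν, NeZero (N ν)] (s t : ℕ) [NeZero s] [NeZero t]

/-! ## §1 Steps, anchors across two scales, the sub-anchor parametrisation -/

omit hN [NeZero s] [NeZero t] in
/-- an anchor of the coarser scale is an anchor of every finer scale `t ∣ s`. [folklore] -/
theorem anchor_of_dvd (hts : t ∣ s) {z : Tor N} (hz : Anchor N s z) : Anchor N t z :=
  fun ν => dvd_trans hts (hz ν)

omit [NeZero t] in
/-- adding `q·t·e_μ` to a scale-`t` anchor gives a scale-`t` anchor (`t ∣ N_μ`; wrap-around allowed). [folklore] -/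
theorem anchor_add_tstep_mul (ht : ∀ ν, t ∣ N ν) {x : Tor N} (hx : Anchor N t x) (μ : Fin d) (q : ℕ) :
    Anchor N t (x + tstep N μ (q * t)) := by
  induction q with
  | zero => simpa [tstep_zero] using hx
  | succ q ih =>
    have e : x + tstep N μ ((q + 1) * t) = (x + tstep N μ (q * t)) + tstep N μ t := by
      rw [Nat.succ_mul, tstep_add, add_assoc]
    rw [e]
    exact anchor_add_tstep N t ht ih μ

omit [NeZero s] in
/-- `t·o_ν < s` for `o_ν < s/t` (`t ∣ s`). [folklore] -/
theorem mul_lt_of_lt_div (hts : t ∣ s) {a : ℕ} (ha : a < s / t) : t * a < s := by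
  calc t * a < t * (s / t) := Nat.mul_lt_mul_of_pos_left ha (s_pos t)
    _ = s := Nat.mul_div_cancel' hts

/-- the scale-`s` offset `t·o` of a scale-`t` multi-index `o ∈ [0, s/t)^d`. [folklore] -/
def mulOff (hts : t ∣ s) (o : Fin d → Fin (s / t)) : Fin d → Fin s :=
  fun ν => ⟨t * (o ν : ℕ), mul_lt_of_lt_div s t hts (o ν).isLt⟩

omit [NeZero s] in
/-- the value of `mulOff`. [folklore] -/
@[simp] theorem mulOff_val (hts : t ∣ s) (o : Fin d → Fin (s / t)) (ν : Fin d) : (mulOff s t hts o ν : ℕ) = t * (o ν : ℕ) := rfl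

omit [NeZero s] in
/-- `z + t·o` is a scale-`t` anchor for a scale-`s` anchor `z` (`t ∣ s ∣ N_ν`). [folklore] -/
theorem anchor_site_mulOff (hs : ∀ ν, s ∣ N ν) (hts : t ∣ s) (z : Anc N s) (o : Fin d → Fin (s / t)) :
    Anchor N t (site N s z.1 (mulOff s t hts o)) := by
  intro ν
  rw [val_site N s hs z.2]
  exact dvd_add (dvd_trans hts (z.2 ν)) ⟨(o ν : ℕ), rfl⟩

/-- **THE SUB-ANCHOR PARAMETRISATION**: for a scale-`s` anchor `z`, a direction `μ`, a multi-index `o ∈ [0,s/t)^d` and `q < s/t`, the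
scale-`t` anchor `z + t·o + q·t·e_μ` — the anchors of the scale-`t` sub-contours into which the scale-`s` contours from `B_s(z)` in
direction `μ` decompose (with multiplicity: the pair `(o, q)` is the index, not the anchor). [folklore] -/
def subAnc (hs : ∀ ν, s ∣ N ν) (ht : ∀ ν, t ∣ N ν) (hts : t ∣ s) (z : Anc N s) (μ : Fin d)
    (o : Fin d → Fin (s / t)) (q : Fin (s / t)) : Anc N t :=
  ⟨site N s z.1 (mulOff s t hts o) + tstep N μ ((q : ℕ) * t),
    anchor_add_tstep_mul N t ht (anchor_site_mulOff N s t hs hts z o) μ q⟩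

omit [NeZero s] in
/-- the underlying site of `subAnc`. [folklore] -/
theorem subAnc_val (hs : ∀ ν, s ∣ N ν) (ht : ∀ ν, t ∣ N ν) (hts : t ∣ s) (z : Anc N s) (μ : Fin d)
    (o : Fin d → Fin (s / t)) (q : Fin (s / t)) :
    (subAnc N s t hs ht hts z μ o q).1 = site N s z.1 (mulOff s t hts o) + tstep N μ ((q : ℕ) * t) := rfl

omit [NeZero s] [NeZero t] in
/-- `t·o_ν + j_ν < s` for `o_ν < s/t`, `j_ν < t`. [folklore] -/
theorem mul_add_lt (hts : t ∣ s) {a b : ℕ} (ha : a < s / t) (hb : b < t) : t * a + b < s := by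
  calc t * a + b < t * a + t := Nat.add_lt_add_left hb _
    _ = t * (a + 1) := by ring
    _ ≤ t * (s / t) := Nat.mul_le_mul_left _ ha
    _ = s := Nat.mul_div_cancel' hts

/-- the COMBINED scale-`s` offset `t·o + j` of `o ∈ [0,s/t)^d` and `j ∈ [0,t)^d`. [folklore] -/
def combOff (hts : t ∣ s) (o : Fin d → Fin (s / t)) (j : Fin d → Fin t) : Fin d → Fin s :=
  fun ν => ⟨t * (o ν : ℕ) + (j ν : ℕ), mul_add_lt s t hts (o ν).isLt (j ν).isLt⟩

omit [NeZero s] [NeZero t] in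
/-- the value of `combOff`. [folklore] -/
@[simp] theorem combOff_val (hts : t ∣ s) (o : Fin d → Fin (s / t)) (j : Fin d → Fin t) (ν : Fin d) :
    (combOff s t hts o j ν : ℕ) = t * (o ν : ℕ) + (j ν : ℕ) := rfl

omit hN [NeZero s] in
/-- offsets compose: `(z + t·o) + j = z + (t·o + j)`. [folklore] -/
theorem site_site_mulOff (hts : t ∣ s) (z : Tor N) (o : Fin d → Fin (s / t)) (j : Fin d → Fin t) :
    site N t (site N s z (mulOff s t hts o)) j = site N s z (combOff s t hts o j) := by
  funext ν
  simp only [site, mulOff_val, combOff_val, Nat.cast_add, add_assoc]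

/-! ## §2 Contour means of means -/

omit [NeZero s] in
/-- the points match: the site of offset `j` in the sub-block of `subAnc z μ o q`, moved `t″` steps, is the site of offset `t·o + j` in
the sub-block of `z`, moved `q·t + t″` steps. [folklore] -/
theorem subAnc_point (hs : ∀ ν, s ∣ N ν) (ht : ∀ ν, t ∣ N ν) (hts : t ∣ s) (z : Anc N s) (μ : Fin d)
    (o : Fin d → Fin (s / t)) (q : Fin (s / t)) (j : Fin d → Fin t) (t'' : ℕ) :
    site N t (subAnc N s t hs ht hts z μ o q).1 j + tstep N μ t''
      = site N s z.1 (combOff s t hts o j) + tstep N μ ((q : ℕ) * t + t'') := by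
  rw [subAnc_val, site_add, site_site_mulOff, tstep_add, add_assoc]

/-- the pair equivalence `Fin (s/t) × Fin t ≃ Fin s`, `(q, t″) ↦ q·t + t″` (Mathlib's `finProdFinEquiv`, cast along `s/t·t = s`). [folklore] -/
def pairEquiv (hts : t ∣ s) : Fin (s / t) × Fin t ≃ Fin s :=
  finProdFinEquiv.trans (finCongr (Nat.div_mul_cancel hts))

omit [NeZero s] [NeZero t] in
/-- the value of `pairEquiv`: `q·t + t″`. [folklore] -/
theorem pairEquiv_val (hts : t ∣ s) (x : Fin (s / t) × Fin t) : (pairEquiv s t hts x : ℕ) = (x.1 : ℕ) * t + (x.2 : ℕ) := by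
  simp only [pairEquiv, Equiv.trans_apply, finCongr_apply, Fin.val_cast, finProdFinEquiv_apply_val]
  ring

/-- the multi-index equivalence `[0,s/t)^d × [0,t)^d ≃ [0,s)^d`, `(o, j) ↦ t·o + j` coordinatewise. [folklore] -/
def multiEquiv (hts : t ∣ s) : (Fin d → Fin (s / t)) × (Fin d → Fin t) ≃ (Fin d → Fin s) :=
  (Equiv.arrowProdEquivProdArrow (Fin d) (fun _ => Fin (s / t)) (fun _ => Fin t)).symm.trans
    (Equiv.piCongrRight fun _ => pairEquiv s t hts)

omit [NeZero s] [NeZero t] in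
/-- `multiEquiv (o, j) = combOff o j`. [folklore] -/
theorem multiEquiv_apply (hts : t ∣ s) (o : Fin d → Fin (s / t)) (j : Fin d → Fin t) :
    multiEquiv s t hts (o, j) = combOff s t hts o j := by
  funext ν
  apply Fin.ext
  simp only [multiEquiv, Equiv.trans_apply, Equiv.piCongrRight_apply, Pi.map_apply]
  show (pairEquiv s t hts ((Equiv.arrowProdEquivProdArrow (Fin d) (fun _ => Fin (s / t)) (fun _ => Fin t)).symm (o, j) ν) : ℕ) = _
  rw [pairEquiv_val]
  show (o ν : ℕ) * t + (j ν : ℕ) = t * (o ν : ℕ) + (j ν : ℕ)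
  ring

omit [NeZero s] [NeZero t] in
/-- `(s/t)^{d+1}·s^{−(d+1)}… bookkeeping`: `((s/t : ℕ) : ℂ) * t = s`. [folklore] -/
theorem cast_div_mul (hts : t ∣ s) : (((s / t : ℕ) : ℂ)) * (t : ℂ) = (s : ℂ) := by
  rw [← Nat.cast_mul, Nat.div_mul_cancel hts]

/-- **CONTOUR MEANS OF MEANS**: `Σ_{o ∈ [0,s/t)^d} Σ_{q < s/t} (Q_t A)(z + t·o + q·t·e_μ, μ) = (s/t)^{d+1}·(Q_s A)(z, μ)` (`t ∣ s`, both
scales dividing the periods). [cite: Balaban1984PropagatorsI, (1.18) p.20 (shape)] [folklore] -/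
theorem avgS_refine (hs : ∀ ν, s ∣ N ν) (ht : ∀ ν, t ∣ N ν) (hts : t ∣ s) (A : Tor N × Fin d → ℂ) (z : Anc N s) (μ : Fin d) :
    ∑ o : Fin d → Fin (s / t), ∑ q : Fin (s / t), (avgS N t *ᵥ A) (subAnc N s t hs ht hts z μ o q, μ)
      = (((s / t : ℕ) : ℂ) ^ (d + 1)) * (avgS N s *ᵥ A) (z, μ) := by
  -- expand both averagings by (1.18) at their scale
  simp_rw [avgS_mulVec N t ht, avgS_mulVec N s hs]
  -- the points of the fine expansions
  have eP : ∀ (o : Fin d → Fin (s / t)) (q : Fin (s / t)) (j : Fin d → Fin t) (t'' : Fin t),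
      A (site N t (subAnc N s t hs ht hts z μ o q).1 j + tstep N μ t'', μ)
        = A (site N s z.1 (combOff s t hts o j) + tstep N μ ((q : ℕ) * t + t''), μ) := by
    intro o q j t''
    rw [subAnc_point]
  simp_rw [eP]
  -- collect: Σ_o Σ_q c * Σ_j Σ_t'' F(combOff o j, q t + t'') = c * Σ_{(o,j)} Σ_{(q,t'')} F …
  set F : (Fin d → Fin s) → ℕ → ℂ := fun J T => A (site N s z.1 J + tstep N μ T, μ) with hF
  have e1 : ∑ o : Fin d → Fin (s / t), ∑ q : Fin (s / t),
      ((t : ℂ) ^ (d + 1))⁻¹ * ∑ j : Fin d → Fin t, ∑ t'' : Fin t, F (combOff s t hts o j) ((q : ℕ) * t + t'')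
      = ((t : ℂ) ^ (d + 1))⁻¹ * ∑ o : Fin d → Fin (s / t), ∑ j : Fin d → Fin t, ∑ q : Fin (s / t), ∑ t'' : Fin t,
          F (combOff s t hts o j) ((q : ℕ) * t + t'') := by
    rw [Finset.mul_sum]
    refine Finset.sum_congr rfl fun o _ => ?_
    rw [← Finset.mul_sum, Finset.sum_comm]
  rw [e1]
  -- reindex (q, t'') ↦ q t + t'' : Fin s
  have e2 : ∀ J : Fin d → Fin s, ∑ q : Fin (s / t), ∑ t'' : Fin t, F J ((q : ℕ) * t + t'') = ∑ T : Fin s, F J (T : ℕ) := by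
    intro J
    rw [← Fintype.sum_prod_type']
    exact Fintype.sum_equiv (pairEquiv s t hts) _ _ fun x => by rw [pairEquiv_val]
  simp_rw [e2]
  -- reindex (o, j) ↦ t o + j : Fin d → Fin s
  have e3 : ∑ o : Fin d → Fin (s / t), ∑ j : Fin d → Fin t, ∑ T : Fin s, F (combOff s t hts o j) (T : ℕ)
      = ∑ J : Fin d → Fin s, ∑ T : Fin s, F J (T : ℕ) := by
    rw [← Fintype.sum_prod_type']
    exact Fintype.sum_equiv (multiEquiv s t hts) _ _ fun x => by rw [multiEquiv_apply]
  rw [e3]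
  -- constants: t^{-(d+1)} = (s/t)^{d+1} * s^{-(d+1)}
  have hs0 : (s : ℂ) ≠ 0 := Nat.cast_ne_zero.mpr (NeZero.ne s)
  have ht0 : (t : ℂ) ≠ 0 := Nat.cast_ne_zero.mpr (NeZero.ne t)
  have ec : ((t : ℂ) ^ (d + 1))⁻¹ = (((s / t : ℕ) : ℂ) ^ (d + 1)) * ((s : ℂ) ^ (d + 1))⁻¹ := by
    rw [← cast_div_mul s t hts, mul_pow, mul_inv, ← mul_assoc, mul_inv_cancel₀ (pow_ne_zero _ ?_), one_mul]
    · intro h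
      apply hs0
      rw [← cast_div_mul s t hts, h, zero_mul]
  rw [ec, mul_assoc]

/-! ## §3 Jensen -/

/-- finite Jensen / Cauchy–Schwarz: `|Σ_i c_i|² ≤ #ι · Σ_i |c_i|²`. [folklore] -/
theorem norm_sq_sum_le {ι : Type*} [Fintype ι] (c : ι → ℂ) :
    ‖∑ i, c i‖ ^ 2 ≤ (Fintype.card ι : ℝ) * ∑ i, ‖c i‖ ^ 2 := by
  calc ‖∑ i, c i‖ ^ 2 ≤ (∑ i, ‖c i‖) ^ 2 := by
        gcongr
        exact norm_sum_le _ _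
    _ ≤ (Finset.univ.card : ℝ) * ∑ i, ‖c i‖ ^ 2 := sq_sum_le_card_mul_sum_sq
    _ = (Fintype.card ι : ℝ) * ∑ i, ‖c i‖ ^ 2 := by rw [Finset.card_univ]

omit [NeZero s] [NeZero t] in
/-- the number of sub-anchor indices `(o, q)`: `(s/t)^d · (s/t) = (s/t)^{d+1}`. [folklore] -/
theorem card_subIdx : (Fintype.card ((Fin d → Fin (s / t)) × Fin (s / t)) : ℝ) = ((s / t : ℕ) : ℝ) ^ (d + 1) := by
  rw [Fintype.card_prod, Fintype.card_fun, Fintype.card_fin, Fintype.card_fin, pow_succ]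
  push_cast
  ring

/-- **JENSEN FOR THE CONTOUR REFINEMENT**: `|(Q_s A)(z,μ)|² ≤ (s/t)^{−(d+1)}·Σ_{o,q} |(Q_t A)(z + t·o + q·t·e_μ, μ)|²`. [folklore] -/
theorem norm_sq_avgS_le (hs : ∀ ν, s ∣ N ν) (ht : ∀ ν, t ∣ N ν) (hts : t ∣ s) (A : Tor N × Fin d → ℂ) (z : Anc N s) (μ : Fin d) :
    ‖(avgS N s *ᵥ A) (z, μ)‖ ^ 2
      ≤ ((((s / t : ℕ) : ℝ)) ^ (d + 1))⁻¹
          * ∑ o : Fin d → Fin (s / t), ∑ q : Fin (s / t), ‖(avgS N t *ᵥ A) (subAnc N s t hs ht hts z μ o q, μ)‖ ^ 2 := by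
  have hne : ((((s / t : ℕ) : ℂ)) ^ (d + 1)) ≠ 0 :=
    pow_ne_zero _ (by exact_mod_cast (Nat.div_pos (Nat.le_of_dvd (s_pos s) hts) (s_pos t)).ne')
  -- (Q_s A)(z,μ) = r^{-(d+1)} Σ_o Σ_q (Q_t A)(sub o q)
  have eM : (avgS N s *ᵥ A) (z, μ) = ((((s / t : ℕ) : ℂ)) ^ (d + 1))⁻¹
      * ∑ o : Fin d → Fin (s / t), ∑ q : Fin (s / t), (avgS N t *ᵥ A) (subAnc N s t hs ht hts z μ o q, μ) := by
    rw [avgS_refine N s t hs ht hts A z μ, ← mul_assoc, inv_mul_cancel₀ hne, one_mul]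
  -- Jensen over the index pairs (o, q)
  have hJ := norm_sq_sum_le
    (fun x : (Fin d → Fin (s / t)) × Fin (s / t) => (avgS N t *ᵥ A) (subAnc N s t hs ht hts z μ x.1 x.2, μ))
  rw [card_subIdx] at hJ
  simp only [Fintype.sum_prod_type] at hJ
  rw [eM, norm_mul, norm_inv, norm_pow, Complex.norm_natCast, mul_pow]
  calc ((((s / t : ℕ) : ℝ)) ^ (d + 1))⁻¹ ^ 2
        * ‖∑ o : Fin d → Fin (s / t), ∑ q : Fin (s / t), (avgS N t *ᵥ A) (subAnc N s t hs ht hts z μ o q, μ)‖ ^ 2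
      ≤ ((((s / t : ℕ) : ℝ)) ^ (d + 1))⁻¹ ^ 2 * ((((s / t : ℕ) : ℝ)) ^ (d + 1)
        * ∑ o : Fin d → Fin (s / t), ∑ q : Fin (s / t), ‖(avgS N t *ᵥ A) (subAnc N s t hs ht hts z μ o q, μ)‖ ^ 2) :=
        mul_le_mul_of_nonneg_left hJ (by positivity)
    _ = ((((s / t : ℕ) : ℝ)) ^ (d + 1))⁻¹
        * ∑ o : Fin d → Fin (s / t), ∑ q : Fin (s / t), ‖(avgS N t *ᵥ A) (subAnc N s t hs ht hts z μ o q, μ)‖ ^ 2 := by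
        field_simp

end Summit.QuantumFields.BalabanUV.T4Continuum.GradedContourRefine

end
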